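/-
Copyright (c) 2026 the pub-hodgecm-mathlib formalisation cell (harness21).  Prover seat hodgecm-mathlib-K2E4-p11 (g9): Track B «K2-LIT»,
hLiu418 = stmt-HodgeConjecture-24832, socket #41 KIND W, organ «Φ6b-ind» (R3) growth, FILE G2 (KW desk F0P2-p08 (g4) 01:26:19Z «(R3) census GO»):
DECAY OF THE TRACE MOMENTS OF SHIMURA's ξ IN THE DIAGONAL ENTRY `h₀₀` OF THE INDEX, EVERY SIGNATURE — by a CONTOUR SHIFT of the first chart
coordinate into the strip (Paley–Wiener).  THEOREMS ONLY (no `def`, no `instance`, no `notation`, no named-fact hypothesis, no `sorry`).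
-/
import Summits.HodgeConjecture.HodgeConjecture.Theorems.K2LiuHermTwoXiStripBounds              -- ★ G1 (this seat): strip algebra and majorants
import Summits.HodgeConjecture.HodgeConjecture.Theorems.K2LiuHermTwoXiIntegrandLineDeriv         -- ★ `det_add_I_smul_hermTwo_mem_slitPlane`
import Summits.HodgeConjecture.HodgeConjecture.Theorems.K2LiuArchIntertwiningScalarSection      -- ★ `det_sub_I_smul_mem_slitPlane`
import Summits.HodgeConjecture.HodgeConjecture.Theorems.K2LiuXiTwoMomentsAsHDerivatives          -- ★ `integrable_moment`, `eval_traceForm`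
import Literature.Analysis.Quadrature.TrapezoidalRuleRealLine                                   -- ★ Paley–Wiener `norm_fourier_le_exp_mul_integral`
import HarnessLib

/-!
# Crux `HLiu418`, ROAD Φ ∕ KIND W organ «Φ6b-ind», (R3) FILE G2: decay of the trace moments of ξ in `h₀₀` by a contour shift

Cell `hodgecm-mathlib`, crux item hLiu418 = `stmt-HodgeConjecture-24832` (helper lane `--supports … --as helper`, count-neutral), route of record
`HCCMUnconditional`; squad K2 ∕ K2Liu, road `K2_Liu`, socket #41, KIND W.

WHAT.  `M_e(h; α, β) = ∫ (−2πi·tr(Θx))^e·ξ-integrand(1, h; α, β)(x) dx` (the `e`-th `h`-line jet of ξ, ★ `iteratedDeriv_xiTwo_hLine`), `h` hermitian of ANY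
signature, `re(α+β) > 3 + e`.  **`norm_traceMoment_le_exp_neg_entry`**:
  `‖M_e(h; α, β)‖ ≤ C(α, β, e, Θ)·e^{−π|re h₀₀|∕2}`,
  `C = (20π·Σ|Θ_jk|)^e · 9^{|re α|} · e^{2π(|im α|+|im β|)} · 9^{re(α+β)−e} · ∫ |det(1 + ix)|^{−(re(α+β)−e)} dx`
— a constant INDEPENDENT of `h`.  PROOF (contour shift): in the chart `x = hermTwo(a, z, b)`, `e(−tr(hx)) = e(−h₀₀a)·e(−tr(h·hermTwo(0,z,b)))`, so fibrewise in
`(z, b)` the `a`-integral is the one-dimensional Fourier transform at `ξ = h₀₀` of `w_{z,b}`, which extends holomorphically to the strip `|im a| < ½` (★ G1: its two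
bases at `a + iτ` are `det(diag(1+τ,1) − ix)`, `det(diag(1−τ,1) + ix)`, in the slit plane); ★ `Literature.Analysis.Quadrature.norm_fourier_le_exp_mul_integral`
(Trefethen–Weideman's Paley–Wiener step) shifts the line to `im a = ∓¼` at the cost `e^{−π|ξ|∕2}`, and the shifted integrand has the `h`-free integrable majorant
of ★ G1; Fubini over `(z, b)`.
[Shimura1982, §4 (decay of the confluent hypergeometric functions in `h`)] [TrefethenWeideman2014, Thm. 5.1 (proof)].
HONEST LABEL.  Count-neutral helper of the K2_Liu road; it pays no socket by itself: `HC_CM` is proved only modulo the 7 printed citations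
(2 remaining named inputs: hLiu418 = `stmt-HodgeConjecture-24832`, h413 = `stmt-HodgeConjecture-24833`) until rung 0 closes.

## References
* [Shimura1982] G. Shimura, *Confluent hypergeometric functions on tube domains*, Math. Ann. 260 (1982) 269–302: §4.
* [TrefethenWeideman2014] L. N. Trefethen, J. A. C. Weideman, *The exponentially convergent trapezoidal rule*, SIAM Rev. 56 (2014): Thm. 5.1.
-/

set_option autoImplicit false
-- the mandated namespace repeats the single-problem summit's segment (`HodgeConjecture.HodgeConjecture`)
set_option linter.dupNamespace false

noncomputable section

open scoped Matrix ComplexConjugate ComplexOrder FourierTransform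
open Complex Matrix MeasureTheory

namespace Summit.HodgeConjecture.HodgeConjecture.Cruxes.HLiu418.K2LiuHermTwoXiMomentStripDecay

open Summit.HodgeConjecture.HodgeConjecture.Cruxes.HLiu418.K2LiuHermTwoGammaDefs
open Summit.HodgeConjecture.HodgeConjecture.Cruxes.HLiu418.K2LiuHermTwoConfluentXiDefs
open Summit.HodgeConjecture.HodgeConjecture.Cruxes.HLiu418.K2LiuHermTwoDetPowerIntegrable
open Summit.HodgeConjecture.HodgeConjecture.Cruxes.HLiu418.K2LiuHermTwoConfluentXiConvergence (norm_cexp_neg_two_pi_I_mul_ofReal)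
open Summit.HodgeConjecture.HodgeConjecture.Cruxes.HLiu418.K2LiuHermTwoXiIntegrandLineDeriv (det_add_I_smul_hermTwo_mem_slitPlane)
open Summit.HodgeConjecture.HodgeConjecture.Cruxes.HLiu418.K2LiuArchIntertwiningScalarSection (det_sub_I_smul_mem_slitPlane)
open Summit.HodgeConjecture.HodgeConjecture.Cruxes.HLiu418.K2LiuXiTwoMomentsAsHDerivatives (integrable_moment eval_traceForm totalDegree_traceForm_le)
open Summit.HodgeConjecture.HodgeConjecture.Cruxes.HLiu418.K2LiuHermTwoXiStripBounds

/-! ## §1 The fibre functions and their properties -/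

/-- Positivity data of the diagonal `diag(p, 1)`, `p > 0`, in the `hermTwo` chart. -/
theorem diag_posData {p : ℝ} (hp : 0 < p) :
    0 < (p, (0 : ℂ), (1 : ℝ)).1 ∧ normSq (p, (0 : ℂ), (1 : ℝ)).2.1 < (p, (0 : ℂ), (1 : ℝ)).1 * (p, (0 : ℂ), (1 : ℝ)).2.2 :=
  ⟨hp, by simp only [map_zero, mul_one]; exact hp⟩

/-- `diag(p, 1)` is positive definite for `p > 0`. -/
theorem diag_posDef {p : ℝ} (hp : 0 < p) : (hermTwo (p, (0 : ℂ), (1 : ℝ))).PosDef :=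
  (posDef_hermTwo_iff _).mpr (diag_posData hp)

/-- THE CHARACTER SPLITS OFF `e(−h₀₀a)`: `e^{−2πi a·re h₀₀}·e(−tr(h·hermTwo(0,z,b))) = e(−tr(h·hermTwo(a,z,b)))` for hermitian `h`. [folklore] -/
theorem cexp_split {h : Matrix (Fin 2) (Fin 2) ℂ} (hh : h.IsHermitian) (a b : ℝ) (z : ℂ) :
    cexp ((((-2 * Real.pi * a * (h 0 0).re : ℝ)) : ℂ) * I) * cexp (-(2 * Real.pi * I) * (h * hermTwo (0, z, b)).trace) =
      cexp (-(2 * Real.pi * I) * (h * hermTwo (a, z, b)).trace) := by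
  rw [← Complex.exp_add, trace_mul_hermTwo_of_isHermitian hh, trace_mul_hermTwo_of_isHermitian hh]
  congr 1
  push_cast
  ring

/-- **THE FIBREWISE FOURIER INTEGRAND**: for real `a`, `e^{−2πi a ξ}·w_{z,b}(a)` (with `ξ = re h₀₀`) IS the trace-moment integrand at `hermTwo(a, z, b)`. [folklore] -/
theorem fourierIntegrand_eq {h : Matrix (Fin 2) (Fin 2) ℂ} (hh : h.IsHermitian) (Θ : Matrix (Fin 2) (Fin 2) ℂ) (α β : ℂ) (e : ℕ)
    (z : ℂ) (b a : ℝ) :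
    cexp ((((-2 * Real.pi * a * (h 0 0).re : ℝ)) : ℂ) * I) •
        (cexp (-(2 * Real.pi * I) * (h * hermTwo (0, z, b)).trace) *
          ((-(2 * Real.pi * I) * (Θ 0 0 * (a : ℂ) + Θ 0 1 * conj z + Θ 1 0 * z + Θ 1 1 * (b : ℂ))) ^ e *
            ((cexp (-(Real.pi * I) * α) * ((1 - I * (a : ℂ)) * (1 - I * (b : ℂ)) + z * conj z) ^ (-α)) *
              (cexp ((Real.pi * I) * β) * ((1 + I * (a : ℂ)) * (1 + I * (b : ℂ)) + z * conj z) ^ (-β))))) =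
      (-(2 * Real.pi * I) * (Θ * hermTwo (a, z, b)).trace) ^ e * xiTwoIntegrand 1 h α β (a, z, b) := by
  rw [smul_eq_mul, xiTwoIntegrand_apply, ← cexp_split hh a b z, base_sub_eq_det_one, base_add_eq_det_one, trace_mul_hermTwo Θ (a, z, b)]
  ring

/-- **HOLOMORPHY OF THE FIBRE FUNCTION ON THE STRIP `|im ζ| < ½`** (its two bases are determinants `det(diag(1+τ,1) − ix)`, `det(diag(1−τ,1) + ix)` of
positive definite diagonal matrices against hermitian `x`, hence in the slit plane). [folklore] -/
theorem differentiableAt_fibre (h Θ : Matrix (Fin 2) (Fin 2) ℂ) (α β : ℂ) (e : ℕ) (z : ℂ) (b : ℝ) {ζ : ℂ} (hζ : |ζ.im| < 1 / 2) :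
    DifferentiableAt ℂ (fun ζ : ℂ =>
      cexp (-(2 * Real.pi * I) * (h * hermTwo (0, z, b)).trace) *
        ((-(2 * Real.pi * I) * (Θ 0 0 * ζ + Θ 0 1 * conj z + Θ 1 0 * z + Θ 1 1 * (b : ℂ))) ^ e *
          ((cexp (-(Real.pi * I) * α) * ((1 - I * ζ) * (1 - I * (b : ℂ)) + z * conj z) ^ (-α)) *
            (cexp ((Real.pi * I) * β) * ((1 + I * ζ) * (1 + I * (b : ℂ)) + z * conj z) ^ (-β))))) ζ := by
  have hτ1 : 0 < 1 + ζ.im := by linarith [(abs_lt.mp hζ).1]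
  have hτ2 : 0 < 1 - ζ.im := by linarith [(abs_lt.mp hζ).2]
  have hζeq : (ζ.re : ℂ) + (ζ.im : ℂ) * I = ζ := Complex.re_add_im ζ
  have hs1 : (1 - I * ζ) * (1 - I * (b : ℂ)) + z * conj z ∈ slitPlane := by
    rw [← hζeq, strip_base_sub_eq]
    exact det_sub_I_smul_mem_slitPlane (diag_posDef hτ1) _
  have hs2 : (1 + I * ζ) * (1 + I * (b : ℂ)) + z * conj z ∈ slitPlane := by
    rw [← hζeq, strip_base_add_eq]
    exact det_add_I_smul_hermTwo_mem_slitPlane (diag_posDef hτ2) _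
  have hb1 : DifferentiableAt ℂ (fun ζ : ℂ => (1 - I * ζ) * (1 - I * (b : ℂ)) + z * conj z) ζ := by fun_prop
  have hb2 : DifferentiableAt ℂ (fun ζ : ℂ => (1 + I * ζ) * (1 + I * (b : ℂ)) + z * conj z) ζ := by fun_prop
  have hp1 := hb1.cpow (differentiableAt_const (-α)) hs1
  have hp2 := hb2.cpow (differentiableAt_const (-β)) hs2
  have hlin : DifferentiableAt ℂ (fun ζ : ℂ => (-(2 * Real.pi * I) * (Θ 0 0 * ζ + Θ 0 1 * conj z + Θ 1 0 * z + Θ 1 1 * (b : ℂ))) ^ e) ζ := by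
    fun_prop
  exact (differentiableAt_const _).mul (hlin.mul (((differentiableAt_const _).mul hp1).mul ((differentiableAt_const _).mul hp2)))

/-- **THE FIBRE FUNCTION ON THE SHIFTED LINE `im ζ = τ` IS THE TWO-«g» INTEGRAND** (★ G1 `strip_base_sub_eq`, `strip_base_add_eq`). [folklore] -/
theorem fibre_shift_eq (h Θ : Matrix (Fin 2) (Fin 2) ℂ) (α β : ℂ) (e : ℕ) (z : ℂ) (b τ a : ℝ) :
    cexp (-(2 * Real.pi * I) * (h * hermTwo (0, z, b)).trace) *
        ((-(2 * Real.pi * I) * (Θ 0 0 * ((a : ℂ) + (τ : ℂ) * I) + Θ 0 1 * conj z + Θ 1 0 * z + Θ 1 1 * (b : ℂ))) ^ e *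
          ((cexp (-(Real.pi * I) * α) * ((1 - I * ((a : ℂ) + (τ : ℂ) * I)) * (1 - I * (b : ℂ)) + z * conj z) ^ (-α)) *
            (cexp ((Real.pi * I) * β) * ((1 + I * ((a : ℂ) + (τ : ℂ) * I)) * (1 + I * (b : ℂ)) + z * conj z) ^ (-β)))) =
      cexp (-(2 * Real.pi * I) * (h * hermTwo (0, z, b)).trace) *
        ((-(2 * Real.pi * I) * (Θ 0 0 * ((a : ℂ) + (τ : ℂ) * I) + Θ 0 1 * conj z + Θ 1 0 * z + Θ 1 1 * (b : ℂ))) ^ e *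
          ((cexp (-(Real.pi * I) * α) * (hermTwo (1 + τ, 0, 1) - I • hermTwo (a, z, b)).det ^ (-α)) *
            (cexp ((Real.pi * I) * β) * (hermTwo (1 - τ, 0, 1) + I • hermTwo (a, z, b)).det ^ (-β)))) := by
  rw [strip_base_sub_eq, strip_base_add_eq]

/-- **THE UNIFORM MAJORANT OF THE SHIFTED INTEGRAND** (`|τ| ≤ ½`, `h` hermitian):
`‖(shifted integrand)(a,z,b)‖ ≤ (20πΣ|Θ|)^e·9^{|re α|}·e^{2π(|im α|+|im β|)}·|det(diag(1−τ,1) + ix)|^{−(re(α+β)−e)}`. [folklore] -/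
theorem norm_fibre_shift_le {h : Matrix (Fin 2) (Fin 2) ℂ} (hh : h.IsHermitian) (Θ : Matrix (Fin 2) (Fin 2) ℂ) (α β : ℂ) (e : ℕ)
    {τ : ℝ} (hτ : |τ| ≤ 1 / 2) (a b : ℝ) (z : ℂ) :
    ‖cexp (-(2 * Real.pi * I) * (h * hermTwo (0, z, b)).trace) *
        ((-(2 * Real.pi * I) * (Θ 0 0 * ((a : ℂ) + (τ : ℂ) * I) + Θ 0 1 * conj z + Θ 1 0 * z + Θ 1 1 * (b : ℂ))) ^ e *
          ((cexp (-(Real.pi * I) * α) * (hermTwo (1 + τ, 0, 1) - I • hermTwo (a, z, b)).det ^ (-α)) *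
            (cexp ((Real.pi * I) * β) * (hermTwo (1 - τ, 0, 1) + I • hermTwo (a, z, b)).det ^ (-β))))‖ ≤
      (20 * Real.pi * (‖Θ 0 0‖ + ‖Θ 0 1‖ + ‖Θ 1 0‖ + ‖Θ 1 1‖)) ^ e * (9 : ℝ) ^ |α.re| * Real.exp (2 * Real.pi * (|α.im| + |β.im|)) *
        ‖(hermTwo (1 - τ, 0, 1) + I • hermTwo (a, z, b)).det‖ ^ (-((α + β).re - e)) := by
  have hτa := abs_le.mp hτ
  set D : ℝ := ‖(hermTwo (1 - τ, 0, 1) + I • hermTwo (a, z, b)).det‖ with hD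
  have hDpos : 0 < D :=
    lt_of_lt_of_le (by rw [mul_one]; linarith [hτa.2]) (mul_le_norm_det_diag (p := 1 - τ) (q := 1) (by linarith [hτa.2]) one_pos (a, z, b))
  have h0 : ‖cexp (-(2 * Real.pi * I) * (h * hermTwo (0, z, b)).trace)‖ = 1 := by
    rw [trace_mul_hermTwo_of_isHermitian hh]; exact norm_cexp_neg_two_pi_I_mul_ofReal _
  have h1 := norm_linWeight_le Θ hτ a b z
  have h2 := norm_cpow_pair_le (p := 1 + τ) (q := 1) (p' := 1 - τ) (q' := 1) (by linarith) (by linarith) (by norm_num) (by norm_num)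
    (by linarith) (by linarith) (by norm_num) (by norm_num) α β (a, z, b)
  have h3 : ‖cexp (-(Real.pi * I) * α)‖ * ‖cexp ((Real.pi * I) * β)‖ ≤ Real.exp (Real.pi * (|α.im| + |β.im|)) := by
    rw [Complex.norm_exp, Complex.norm_exp, ← Real.exp_add]
    refine Real.exp_le_exp.mpr ?_
    simp only [neg_mul, neg_re, mul_re, mul_im, ofReal_re, ofReal_im, I_re, I_im, mul_zero, zero_mul, sub_zero, mul_one, zero_sub,
      neg_neg, add_zero]
    nlinarith [le_abs_self α.im, neg_abs_le α.im, le_abs_self β.im, neg_abs_le β.im, Real.pi_pos]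
  set L := -(2 * Real.pi * I) * (Θ 0 0 * ((a : ℂ) + (τ : ℂ) * I) + Θ 0 1 * conj z + Θ 1 0 * z + Θ 1 1 * (b : ℂ)) with hL
  set P := (hermTwo (1 + τ, 0, 1) - I • hermTwo (a, z, b)).det ^ (-α) with hP
  set Q := (hermTwo (1 - τ, 0, 1) + I • hermTwo (a, z, b)).det ^ (-β) with hQ
  set K : ℝ := 20 * Real.pi * (‖Θ 0 0‖ + ‖Θ 0 1‖ + ‖Θ 1 0‖ + ‖Θ 1 1‖) with hK
  have hK0 : 0 ≤ K := by positivity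
  have hnorm : ‖cexp (-(2 * Real.pi * I) * (h * hermTwo (0, z, b)).trace) * (L ^ e * ((cexp (-(Real.pi * I) * α) * P) * (cexp ((Real.pi * I) * β) * Q)))‖ =
      ‖L‖ ^ e * ((‖cexp (-(Real.pi * I) * α)‖ * ‖cexp ((Real.pi * I) * β)‖) * ‖P * Q‖) := by
    rw [norm_mul, h0, one_mul, show (cexp (-(Real.pi * I) * α) * P) * (cexp ((Real.pi * I) * β) * Q) =
      (cexp (-(Real.pi * I) * α) * cexp ((Real.pi * I) * β)) * (P * Q) by ring, norm_mul, norm_mul, norm_mul, norm_pow]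
  rw [hnorm]
  have hLe : ‖L‖ ^ e ≤ K ^ e * D ^ (e : ℝ) := by
    rw [Real.rpow_natCast, ← mul_pow]
    exact pow_le_pow_left₀ (norm_nonneg _) h1 e
  have hPQ : (‖cexp (-(Real.pi * I) * α)‖ * ‖cexp ((Real.pi * I) * β)‖) * ‖P * Q‖ ≤
      Real.exp (Real.pi * (|α.im| + |β.im|)) * (Real.exp (Real.pi * (|α.im| + |β.im|)) * (9 : ℝ) ^ |α.re| * D ^ (-(α + β).re)) :=
    mul_le_mul h3 h2 (norm_nonneg _) (Real.exp_pos _).le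
  have hexp : Real.exp (Real.pi * (|α.im| + |β.im|)) * Real.exp (Real.pi * (|α.im| + |β.im|)) = Real.exp (2 * Real.pi * (|α.im| + |β.im|)) := by
    rw [← Real.exp_add]; ring_nf
  have hpow : D ^ (e : ℝ) * D ^ (-(α + β).re) = D ^ (-((α + β).re - e)) := by
    rw [← Real.rpow_add hDpos]; ring_nf
  calc ‖L‖ ^ e * ((‖cexp (-(Real.pi * I) * α)‖ * ‖cexp ((Real.pi * I) * β)‖) * ‖P * Q‖)
      ≤ (K ^ e * D ^ (e : ℝ)) * (Real.exp (Real.pi * (|α.im| + |β.im|)) * (Real.exp (Real.pi * (|α.im| + |β.im|)) * (9 : ℝ) ^ |α.re| * D ^ (-(α + β).re))) :=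
        mul_le_mul hLe hPQ (by positivity) (by positivity)
    _ = K ^ e * (9 : ℝ) ^ |α.re| * Real.exp (2 * Real.pi * (|α.im| + |β.im|)) * D ^ (-((α + β).re - e)) := by
        rw [← hexp, ← hpow]; ring

/-- The shifted integrand is measurable in `(a, z, b)`. [folklore] -/
theorem measurable_fibre_shift (h Θ : Matrix (Fin 2) (Fin 2) ℂ) (α β : ℂ) (e : ℕ) (τ : ℝ) :
    Measurable (fun c : ℝ × ℂ × ℝ =>
      cexp (-(2 * Real.pi * I) * (h * hermTwo (0, c.2.1, c.2.2)).trace) *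
        ((-(2 * Real.pi * I) * (Θ 0 0 * ((c.1 : ℂ) + (τ : ℂ) * I) + Θ 0 1 * conj c.2.1 + Θ 1 0 * c.2.1 + Θ 1 1 * (c.2.2 : ℂ))) ^ e *
          ((cexp (-(Real.pi * I) * α) * (hermTwo (1 + τ, 0, 1) - I • hermTwo c).det ^ (-α)) *
            (cexp ((Real.pi * I) * β) * (hermTwo (1 - τ, 0, 1) + I • hermTwo c).det ^ (-β))))) := by
  have hc : Continuous (fun c : ℝ × ℂ × ℝ => (h * hermTwo (0, c.2.1, c.2.2)).trace) := by
    simp only [trace_mul_hermTwo]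
    fun_prop
  have hl : Continuous (fun c : ℝ × ℂ × ℝ =>
      (-(2 * Real.pi * I) * (Θ 0 0 * ((c.1 : ℂ) + (τ : ℂ) * I) + Θ 0 1 * conj c.2.1 + Θ 1 0 * c.2.1 + Θ 1 1 * (c.2.2 : ℂ))) ^ e) := by
    fun_prop
  refine (Complex.measurable_exp.comp (measurable_const.mul hc.measurable)).mul (hl.measurable.mul (Measurable.mul ?_ ?_))
  · exact measurable_const.mul ((continuous_det_sub_I_smul_hermTwo _).measurable.pow_const _)
  · exact measurable_const.mul ((continuous_det_add_I_smul_hermTwo _).measurable.pow_const _)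

/-- **THE SHIFTED INTEGRAND IS INTEGRABLE, WITH AN `h`-FREE BOUND ON ITS `L¹` NORM** (`|τ| ≤ ½`, `re(α+β) > 3 + e`). [folklore] -/
theorem integrable_fibre_shift {h : Matrix (Fin 2) (Fin 2) ℂ} (hh : h.IsHermitian) (Θ : Matrix (Fin 2) (Fin 2) ℂ) {α β : ℂ} (e : ℕ)
    (hαβ : 3 + (e : ℝ) < (α + β).re) {τ : ℝ} (hτ : |τ| ≤ 1 / 2) :
    Integrable (fun c : ℝ × ℂ × ℝ =>
      cexp (-(2 * Real.pi * I) * (h * hermTwo (0, c.2.1, c.2.2)).trace) *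
        ((-(2 * Real.pi * I) * (Θ 0 0 * ((c.1 : ℂ) + (τ : ℂ) * I) + Θ 0 1 * conj c.2.1 + Θ 1 0 * c.2.1 + Θ 1 1 * (c.2.2 : ℂ))) ^ e *
          ((cexp (-(Real.pi * I) * α) * (hermTwo (1 + τ, 0, 1) - I • hermTwo c).det ^ (-α)) *
            (cexp ((Real.pi * I) * β) * (hermTwo (1 - τ, 0, 1) + I • hermTwo c).det ^ (-β))))) ∧
    ∫ c : ℝ × ℂ × ℝ, ‖cexp (-(2 * Real.pi * I) * (h * hermTwo (0, c.2.1, c.2.2)).trace) *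
        ((-(2 * Real.pi * I) * (Θ 0 0 * ((c.1 : ℂ) + (τ : ℂ) * I) + Θ 0 1 * conj c.2.1 + Θ 1 0 * c.2.1 + Θ 1 1 * (c.2.2 : ℂ))) ^ e *
          ((cexp (-(Real.pi * I) * α) * (hermTwo (1 + τ, 0, 1) - I • hermTwo c).det ^ (-α)) *
            (cexp ((Real.pi * I) * β) * (hermTwo (1 - τ, 0, 1) + I • hermTwo c).det ^ (-β))))‖ ≤
      (20 * Real.pi * (‖Θ 0 0‖ + ‖Θ 0 1‖ + ‖Θ 1 0‖ + ‖Θ 1 1‖)) ^ e * (9 : ℝ) ^ |α.re| * Real.exp (2 * Real.pi * (|α.im| + |β.im|)) *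
        ((9 : ℝ) ^ ((α + β).re - e) * ∫ c : ℝ × ℂ × ℝ, ‖((1 : Matrix (Fin 2) (Fin 2) ℂ) + I • hermTwo c).det‖ ^ (-((α + β).re - e))) := by
  have hτa := abs_le.mp hτ
  set σ : ℝ := (α + β).re - e with hσ
  have hσ3 : 3 < σ := by rw [hσ]; linarith
  set K : ℝ := (20 * Real.pi * (‖Θ 0 0‖ + ‖Θ 0 1‖ + ‖Θ 1 0‖ + ‖Θ 1 1‖)) ^ e * (9 : ℝ) ^ |α.re| * Real.exp (2 * Real.pi * (|α.im| + |β.im|)) with hK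
  have hK0 : 0 ≤ K := by positivity
  have hmaj : Integrable (fun c : ℝ × ℂ × ℝ => ‖(hermTwo (1 - τ, 0, 1) + I • hermTwo c).det‖ ^ (-σ)) :=
    integrable_norm_det_rpow_neg_hermTwo (1 - τ, (0 : ℂ), (1 : ℝ)) (diag_posData (by linarith)) hσ3
  have hone : Integrable (fun c : ℝ × ℂ × ℝ => ‖((1 : Matrix (Fin 2) (Fin 2) ℂ) + I • hermTwo c).det‖ ^ (-σ)) := by
    have := integrable_norm_det_rpow_neg_hermTwo ((1 : ℝ), (0 : ℂ), (1 : ℝ)) (diag_posData one_pos) hσ3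
    simpa only [hermTwo_one_zero_one] using this
  have hcmp : ∀ c : ℝ × ℂ × ℝ, ‖(hermTwo (1 - τ, 0, 1) + I • hermTwo c).det‖ ^ (-σ) ≤
      (9 : ℝ) ^ σ * ‖((1 : Matrix (Fin 2) (Fin 2) ℂ) + I • hermTwo c).det‖ ^ (-σ) := by
    intro c
    have hB : 0 < ‖(hermTwo (1 - τ, 0, 1) + I • hermTwo c).det‖ :=
      lt_of_lt_of_le (by nlinarith) (mul_le_norm_det_diag (p := 1 - τ) (q := 1) (by linarith) one_pos c)
    have h1 : ‖((1 : Matrix (Fin 2) (Fin 2) ℂ) + I • hermTwo c).det‖ ≤ 9 * ‖(hermTwo (1 - τ, 0, 1) + I • hermTwo c).det‖ := by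
      have := norm_det_diag_le_nine_mul (p := 1) (q := 1) (p' := 1 - τ) (q' := 1) (by norm_num) (by norm_num) (by norm_num) (by norm_num)
        (by linarith) (by norm_num) c
      simpa only [hermTwo_one_zero_one] using this
    have h1' : ‖((1 : Matrix (Fin 2) (Fin 2) ℂ) + I • hermTwo c).det‖ / 9 ≤ ‖(hermTwo (1 - τ, 0, 1) + I • hermTwo c).det‖ := by
      rw [div_le_iff₀ (by norm_num)]; linarith
    have hone_pos : 0 < ‖((1 : Matrix (Fin 2) (Fin 2) ℂ) + I • hermTwo c).det‖ := by
      have := mul_le_norm_det_diag (p := 1) (q := 1) one_pos one_pos c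
      rw [hermTwo_one_zero_one] at this
      linarith
    calc ‖(hermTwo (1 - τ, 0, 1) + I • hermTwo c).det‖ ^ (-σ)
        ≤ (‖((1 : Matrix (Fin 2) (Fin 2) ℂ) + I • hermTwo c).det‖ / 9) ^ (-σ) :=
          Real.rpow_le_rpow_of_nonpos (by positivity) h1' (by linarith)
      _ = (9 : ℝ) ^ σ * ‖((1 : Matrix (Fin 2) (Fin 2) ℂ) + I • hermTwo c).det‖ ^ (-σ) := by
          rw [Real.div_rpow hone_pos.le (by norm_num), Real.rpow_neg (by norm_num : (0 : ℝ) ≤ 9), div_eq_mul_inv, inv_inv, mul_comm]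
  have hmeas := measurable_fibre_shift h Θ α β e τ
  have hbound : ∀ c : ℝ × ℂ × ℝ, ‖cexp (-(2 * Real.pi * I) * (h * hermTwo (0, c.2.1, c.2.2)).trace) *
      ((-(2 * Real.pi * I) * (Θ 0 0 * ((c.1 : ℂ) + (τ : ℂ) * I) + Θ 0 1 * conj c.2.1 + Θ 1 0 * c.2.1 + Θ 1 1 * (c.2.2 : ℂ))) ^ e *
        ((cexp (-(Real.pi * I) * α) * (hermTwo (1 + τ, 0, 1) - I • hermTwo c).det ^ (-α)) *
          (cexp ((Real.pi * I) * β) * (hermTwo (1 - τ, 0, 1) + I • hermTwo c).det ^ (-β))))‖ ≤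
      K * ‖(hermTwo (1 - τ, 0, 1) + I • hermTwo c).det‖ ^ (-σ) := fun c => norm_fibre_shift_le hh Θ α β e hτ c.1 c.2.2 c.2.1
  have hint : Integrable (fun c : ℝ × ℂ × ℝ =>
      cexp (-(2 * Real.pi * I) * (h * hermTwo (0, c.2.1, c.2.2)).trace) *
        ((-(2 * Real.pi * I) * (Θ 0 0 * ((c.1 : ℂ) + (τ : ℂ) * I) + Θ 0 1 * conj c.2.1 + Θ 1 0 * c.2.1 + Θ 1 1 * (c.2.2 : ℂ))) ^ e *
          ((cexp (-(Real.pi * I) * α) * (hermTwo (1 + τ, 0, 1) - I • hermTwo c).det ^ (-α)) *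
            (cexp ((Real.pi * I) * β) * (hermTwo (1 - τ, 0, 1) + I • hermTwo c).det ^ (-β))))) :=
    Integrable.mono' (hmaj.const_mul K) hmeas.aestronglyMeasurable (Filter.Eventually.of_forall hbound)
  refine ⟨hint, ?_⟩
  calc ∫ c : ℝ × ℂ × ℝ, ‖cexp (-(2 * Real.pi * I) * (h * hermTwo (0, c.2.1, c.2.2)).trace) *
        ((-(2 * Real.pi * I) * (Θ 0 0 * ((c.1 : ℂ) + (τ : ℂ) * I) + Θ 0 1 * conj c.2.1 + Θ 1 0 * c.2.1 + Θ 1 1 * (c.2.2 : ℂ))) ^ e *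
          ((cexp (-(Real.pi * I) * α) * (hermTwo (1 + τ, 0, 1) - I • hermTwo c).det ^ (-α)) *
            (cexp ((Real.pi * I) * β) * (hermTwo (1 - τ, 0, 1) + I • hermTwo c).det ^ (-β))))‖
      ≤ ∫ c : ℝ × ℂ × ℝ, K * ((9 : ℝ) ^ σ * ‖((1 : Matrix (Fin 2) (Fin 2) ℂ) + I • hermTwo c).det‖ ^ (-σ)) := by
        refine integral_mono hint.norm ((hone.const_mul _).const_mul K) fun c => (hbound c).trans ?_
        exact mul_le_mul_of_nonneg_left (hcmp c) hK0
    _ = K * ((9 : ℝ) ^ σ * ∫ c : ℝ × ℂ × ℝ, ‖((1 : Matrix (Fin 2) (Fin 2) ℂ) + I • hermTwo c).det‖ ^ (-σ)) := by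
        rw [integral_const_mul, integral_const_mul]

/-! ## §2 The decay in `h₀₀` -/

/-- The trace-moment integrand is integrable for `re(α+β) > 3 + e` (★ `integrable_moment` with the weight `(−2πi·tr(Θx))^e`). [folklore] -/
theorem integrable_traceMomentIntegrand {h : Matrix (Fin 2) (Fin 2) ℂ} (hh : h.IsHermitian) (Θ : Matrix (Fin 2) (Fin 2) ℂ) (e : ℕ)
    {α β : ℂ} (hαβ : 3 + (e : ℝ) < (α + β).re) :
    Integrable (fun c : ℝ × ℂ × ℝ => (-(2 * Real.pi * I) * (Θ * hermTwo c).trace) ^ e * xiTwoIntegrand 1 h α β c) := by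
  set L : MvPolynomial (Fin 2 × Fin 2) ℂ :=
    MvPolynomial.C (-(2 * Real.pi * I)) * ∑ jk : Fin 2 × Fin 2, MvPolynomial.C (Θ jk.2 jk.1) * MvPolynomial.X jk with hL
  have hLeval : ∀ c : ℝ × ℂ × ℝ, MvPolynomial.eval (fun jk : Fin 2 × Fin 2 => hermTwo c jk.1 jk.2) (L ^ e) = (-(2 * Real.pi * I) * (Θ * hermTwo c).trace) ^ e :=
    fun c => by rw [map_pow, hL, eval_traceForm Θ c]
  have hdeg : ((L ^ e).totalDegree : ℝ) ≤ e := by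
    have h1 : (L ^ e).totalDegree ≤ e * 1 :=
      (MvPolynomial.totalDegree_pow _ _).trans (Nat.mul_le_mul_left _ (by rw [hL]; exact totalDegree_traceForm_le Θ))
    rw [mul_one] at h1
    exact_mod_cast h1
  exact (integrable_moment (L ^ e) hh (A := α) (B := β) (by linarith)).congr (Filter.Eventually.of_forall fun c => by simp only [hLeval])

/-- **DECAY OF THE TRACE MOMENTS OF ξ IN THE DIAGONAL ENTRY `h₀₀`, EVERY SIGNATURE** (organ «Φ6b-ind» (R3), FILE G2): for hermitian `h` (ANY signature),
any `Θ`, `e : ℕ` and `re(α+β) > 3 + e`,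
  `‖∫ (−2πi·tr(Θx))^e·ξ-integrand(1, h; α, β)(x) dx‖ ≤ C(α, β, e, Θ)·e^{−π|re h₀₀|∕2}`,
`C = (20πΣ|Θ_jk|)^e·9^{|re α|}·e^{2π(|im α|+|im β|)}·9^{re(α+β)−e}·∫|det(1+ix)|^{−(re(α+β)−e)}dx` INDEPENDENT of `h`.  Contour shift of the first chart coordinate to
`im a = ∓¼` (Paley–Wiener, ★ `Literature.Analysis.Quadrature.norm_fourier_le_exp_mul_integral`), fibrewise in `(z, b)`, then Fubini.
[cite: Shimura1982, §4] [cite: TrefethenWeideman2014, Thm. 5.1] -/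
theorem norm_traceMoment_le_exp_neg_entry {h Θ : Matrix (Fin 2) (Fin 2) ℂ} (hh : h.IsHermitian) (e : ℕ) {α β : ℂ}
    (hαβ : 3 + (e : ℝ) < (α + β).re) :
    ‖∫ c : ℝ × ℂ × ℝ, (-(2 * Real.pi * I) * (Θ * hermTwo c).trace) ^ e * xiTwoIntegrand 1 h α β c‖ ≤
      (20 * Real.pi * (‖Θ 0 0‖ + ‖Θ 0 1‖ + ‖Θ 1 0‖ + ‖Θ 1 1‖)) ^ e * (9 : ℝ) ^ |α.re| * Real.exp (2 * Real.pi * (|α.im| + |β.im|)) *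
        ((9 : ℝ) ^ ((α + β).re - e) * ∫ c : ℝ × ℂ × ℝ, ‖((1 : Matrix (Fin 2) (Fin 2) ℂ) + I • hermTwo c).det‖ ^ (-((α + β).re - e))) *
          Real.exp (-(Real.pi / 2) * |(h 0 0).re|) := by
  set ξ : ℝ := (h 0 0).re with hξ
  set σ : ℝ := (α + β).re - e with hσ
  have hσ3 : 3 < σ := by rw [hσ]; linarith
  set K : ℝ := (20 * Real.pi * (‖Θ 0 0‖ + ‖Θ 0 1‖ + ‖Θ 1 0‖ + ‖Θ 1 1‖)) ^ e * (9 : ℝ) ^ |α.re| * Real.exp (2 * Real.pi * (|α.im| + |β.im|))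
    with hK
  have hK0 : 0 ≤ K := by positivity
  set τ : ℝ := if 0 ≤ ξ then -(1 / 4) else 1 / 4 with hτdef
  have hτlt : |τ| < 1 / 2 := by rw [hτdef]; split_ifs <;> norm_num [abs_of_nonneg, abs_of_nonpos]
  have hτ : |τ| ≤ 1 / 2 := hτlt.le
  have hτξ : Real.exp (2 * Real.pi * τ * ξ) = Real.exp (-(Real.pi / 2) * |ξ|) := by
    congr 1; rw [hτdef]; split_ifs with h0
    · rw [abs_of_nonneg h0]; ring
    · rw [abs_of_neg (not_le.mp h0)]; ring
  set F : ℝ × ℂ × ℝ → ℂ := fun c => (-(2 * Real.pi * I) * (Θ * hermTwo c).trace) ^ e * xiTwoIntegrand 1 h α β c with hF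
  set G : ℝ × ℂ × ℝ → ℂ := fun c =>
    cexp (-(2 * Real.pi * I) * (h * hermTwo (0, c.2.1, c.2.2)).trace) *
      ((-(2 * Real.pi * I) * (Θ 0 0 * ((c.1 : ℂ) + (τ : ℂ) * I) + Θ 0 1 * conj c.2.1 + Θ 1 0 * c.2.1 + Θ 1 1 * (c.2.2 : ℂ))) ^ e *
        ((cexp (-(Real.pi * I) * α) * (hermTwo (1 + τ, 0, 1) - I • hermTwo c).det ^ (-α)) *
          (cexp ((Real.pi * I) * β) * (hermTwo (1 - τ, 0, 1) + I • hermTwo c).det ^ (-β)))) with hG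
  have hFint : Integrable F := integrable_traceMomentIntegrand hh Θ e hαβ
  obtain ⟨hGint, hGbound⟩ := integrable_fibre_shift hh Θ e hαβ hτ
  have hPW : ∀ᵐ y : ℂ × ℝ, ‖∫ a : ℝ, F (a, y)‖ ≤ Real.exp (-(Real.pi / 2) * |ξ|) * ∫ a : ℝ, ‖G (a, y)‖ := by
    filter_upwards [hFint.prod_left_ae, hGint.prod_left_ae] with y hFy hGy
    obtain ⟨z, b⟩ := y
    set w : ℂ → ℂ := fun ζ : ℂ =>
      cexp (-(2 * Real.pi * I) * (h * hermTwo (0, z, b)).trace) *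
        ((-(2 * Real.pi * I) * (Θ 0 0 * ζ + Θ 0 1 * conj z + Θ 1 0 * z + Θ 1 1 * (b : ℂ))) ^ e *
          ((cexp (-(Real.pi * I) * α) * ((1 - I * ζ) * (1 - I * (b : ℂ)) + z * conj z) ^ (-α)) *
            (cexp ((Real.pi * I) * β) * ((1 + I * ζ) * (1 + I * (b : ℂ)) + z * conj z) ^ (-β)))) with hw
    have hwF : ∀ a : ℝ, cexp ((((-2 * Real.pi * a * ξ : ℝ)) : ℂ) * I) • w a = F (a, (z, b)) := fun a =>
      fourierIntegrand_eq hh Θ α β e z b a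
    have hwG : ∀ τ' a : ℝ, w ((a : ℂ) + (τ' : ℂ) * I) =
        cexp (-(2 * Real.pi * I) * (h * hermTwo (0, z, b)).trace) *
          ((-(2 * Real.pi * I) * (Θ 0 0 * ((a : ℂ) + (τ' : ℂ) * I) + Θ 0 1 * conj z + Θ 1 0 * z + Θ 1 1 * (b : ℂ))) ^ e *
            ((cexp (-(Real.pi * I) * α) * (hermTwo (1 + τ', 0, 1) - I • hermTwo (a, z, b)).det ^ (-α)) *
              (cexp ((Real.pi * I) * β) * (hermTwo (1 - τ', 0, 1) + I • hermTwo (a, z, b)).det ^ (-β)))) := fun τ' a =>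
      fibre_shift_eq h Θ α β e z b τ' a
    have hwd : DifferentiableOn ℂ w {ζ : ℂ | |ζ.im| < 1 / 2} := fun ζ hζ =>
      (differentiableAt_fibre h Θ α β e z b hζ).differentiableWithinAt
    have hwc : Continuous (fun a : ℝ => w a) :=
      continuous_iff_continuousAt.mpr fun a =>
        ((differentiableAt_fibre h Θ α β e z b (ζ := (a : ℂ)) (by simp)).continuousAt).comp continuous_ofReal.continuousAt
    have h0 : Integrable (fun a : ℝ => w a) := by
      refine Integrable.mono' hFy.norm hwc.aestronglyMeasurable (Filter.Eventually.of_forall fun a => ?_)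
      rw [← hwF a, norm_smul, Complex.norm_exp_ofReal_mul_I, one_mul]
    have h1 : Integrable (fun a : ℝ => w ((a : ℂ) + (τ : ℂ) * I)) := by
      refine hGy.congr (Filter.Eventually.of_forall fun a => ?_)
      exact (hwG τ a).symm
    have hvan : ∀ ε > 0, ∃ R : ℝ, ∀ ζ : ℂ, |ζ.im| < 1 / 2 → R ≤ |ζ.re| → ‖w ζ‖ ≤ ε := by
      intro ε hε
      refine ⟨max 1 ((K + 1) / ε), fun ζ hζ hR => ?_⟩
      obtain ⟨a', τ', rfl⟩ : ∃ a' τ' : ℝ, ζ = (a' : ℂ) + (τ' : ℂ) * I := ⟨ζ.re, ζ.im, (Complex.re_add_im ζ).symm⟩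
      have him : ((a' : ℂ) + (τ' : ℂ) * I).im = τ' := by simp
      have hre : ((a' : ℂ) + (τ' : ℂ) * I).re = a' := by simp
      rw [him] at hζ
      rw [hre] at hR
      have hτ' : |τ'| ≤ 1 / 2 := hζ.le
      have hτ'a := abs_le.mp hτ'
      have ha1 : 1 ≤ |a'| := le_trans (le_max_left _ _) hR
      have ha0 : 0 < |a'| := by linarith
      rw [hwG τ' a']
      have hmaj := norm_fibre_shift_le hh Θ α β e hτ' a' b z
      have hdet : |a'| ≤ ‖(hermTwo (1 - τ', 0, 1) + I • hermTwo (a', z, b)).det‖ := by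
        have := mul_abs_le_norm_det_diag (p := 1 - τ') (q := 1) (by linarith) one_pos (a', z, b)
        simpa using this
      have hpow : ‖(hermTwo (1 - τ', 0, 1) + I • hermTwo (a', z, b)).det‖ ^ (-σ) ≤ |a'|⁻¹ := by
        calc ‖(hermTwo (1 - τ', 0, 1) + I • hermTwo (a', z, b)).det‖ ^ (-σ) ≤ |a'| ^ (-σ) :=
              Real.rpow_le_rpow_of_nonpos ha0 hdet (by linarith)
          _ ≤ |a'| ^ (-(1 : ℝ)) := Real.rpow_le_rpow_of_exponent_le ha1 (by linarith)
          _ = |a'|⁻¹ := Real.rpow_neg_one _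
      have hinv : |a'|⁻¹ ≤ ε / (K + 1) := by
        have hR' : (K + 1) / ε ≤ |a'| := le_trans (le_max_right _ _) hR
        have hpos : 0 < (K + 1) / ε := by positivity
        calc |a'|⁻¹ ≤ ((K + 1) / ε)⁻¹ := (inv_le_inv₀ ha0 hpos).mpr hR'
          _ = ε / (K + 1) := by rw [inv_div]
      calc _ ≤ K * ‖(hermTwo (1 - τ', 0, 1) + I • hermTwo (a', z, b)).det‖ ^ (-((α + β).re - e)) := hmaj
        _ ≤ K * (ε / (K + 1)) := mul_le_mul_of_nonneg_left (hpow.trans hinv) hK0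
        _ ≤ ε := by
            rw [mul_div_assoc']
            exact (div_le_iff₀ (by positivity)).mpr (by nlinarith)
    have key := Literature.Analysis.Quadrature.norm_fourier_le_exp_mul_integral (a := 1 / 2) (c := τ) hτlt hwd h0 h1 hvan ξ
    rw [Real.fourier_real_eq_integral_exp_smul, hτξ] at key
    have hlhs : ∫ v : ℝ, cexp ((((-2 * Real.pi * v * ξ : ℝ)) : ℂ) * I) • w v = ∫ a : ℝ, F (a, (z, b)) :=
      integral_congr_ae (Filter.Eventually.of_forall fun a => hwF a)
    have hrhs : ∫ a : ℝ, ‖w ((a : ℂ) + (τ : ℂ) * I)‖ = ∫ a : ℝ, ‖G (a, (z, b))‖ :=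
      integral_congr_ae (Filter.Eventually.of_forall fun a => by simp only [hG]; rw [hwG τ a])
    rw [hlhs, hrhs] at key
    exact key
  have hvol : (volume : Measure (ℝ × ℂ × ℝ)) = (volume : Measure ℝ).prod (volume : Measure (ℂ × ℝ)) := rfl
  have hFub : ∫ c, F c = ∫ y : ℂ × ℝ, ∫ a : ℝ, F (a, y) := by rw [hvol]; exact integral_prod_symm F (hvol ▸ hFint)
  have hGub : ∫ c, ‖G c‖ = ∫ y : ℂ × ℝ, ∫ a : ℝ, ‖G (a, y)‖ := by rw [hvol]; exact integral_prod_symm (fun c => ‖G c‖) (hvol ▸ hGint.norm)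
  have hI1 : Integrable (fun y : ℂ × ℝ => ‖∫ a : ℝ, F (a, y)‖) := (hvol ▸ hFint).integral_prod_right.norm
  have hI2 : Integrable (fun y : ℂ × ℝ => Real.exp (-(Real.pi / 2) * |ξ|) * ∫ a : ℝ, ‖G (a, y)‖) :=
    (hvol ▸ hGint).integral_norm_prod_right.const_mul _
  calc ‖∫ c, F c‖ = ‖∫ y : ℂ × ℝ, ∫ a : ℝ, F (a, y)‖ := by rw [hFub]
    _ ≤ ∫ y : ℂ × ℝ, ‖∫ a : ℝ, F (a, y)‖ := norm_integral_le_integral_norm _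
    _ ≤ ∫ y : ℂ × ℝ, Real.exp (-(Real.pi / 2) * |ξ|) * ∫ a : ℝ, ‖G (a, y)‖ := integral_mono_ae hI1 hI2 hPW
    _ = Real.exp (-(Real.pi / 2) * |ξ|) * ∫ c, ‖G c‖ := by rw [integral_const_mul, hGub]
    _ ≤ Real.exp (-(Real.pi / 2) * |ξ|) *
          (K * ((9 : ℝ) ^ σ * ∫ c : ℝ × ℂ × ℝ, ‖((1 : Matrix (Fin 2) (Fin 2) ℂ) + I • hermTwo c).det‖ ^ (-σ))) :=
        mul_le_mul_of_nonneg_left hGbound (Real.exp_pos _).le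
    _ = K * ((9 : ℝ) ^ σ * ∫ c : ℝ × ℂ × ℝ, ‖((1 : Matrix (Fin 2) (Fin 2) ℂ) + I • hermTwo c).det‖ ^ (-σ)) *
          Real.exp (-(Real.pi / 2) * |ξ|) := by ring

end Summit.HodgeConjecture.HodgeConjecture.Cruxes.HLiu418.K2LiuHermTwoXiMomentStripDecay

end
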